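import Literature.Barriers.BirchSwinnertonDyer.DescentDefectUnbounded
import Literature.Barriers.BirchSwinnertonDyer.DescentDefectUnboundedRankCalculus
import Literature.NumberTheory.EllipticCurves.MordellCurveThreeDescentLocal
import HarnessLib

/-!
# Barrier (BirchSwinnertonDyer): `Cassels1964_sha_threeRank_jZero` — the source read; the model; the reduction

`Proofs` companion of `Literature/Barriers/BirchSwinnertonDyer/DescentDefectUnbounded.lean` for
its named fact `Literature.Barriers.BirchSwinnertonDyer.Cassels1964_sha_threeRank_jZero`, which
was vendored there from three printed REPORTS of Cassels' theorem (Matsuno 2009 §1, Clark–Sharif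
2010 §1.3, Kramer 1983 §1), the 1964 paper being unavailable at the time (scope_caveats (c) of
`TwoDescentDefectUnbounded`). The paper has now been READ in full — J. W. S. Cassels,
*Arithmetic on curves of genus 1. VI. The Tate–Šafarevič group can be arbitrarily large*,
J. reine angew. Math. **214/215** (1964) 65–70 [Cassels1964ArithmeticVI], open scan of the
Göttinger Digitalisierungszentrum (volume `PPN243919689_0214_0215`, article `LOG_0011`,
EuDML doc 150606), pp. 65–70 — and this file records (1) the printed theorem and the
confirmation that the vendored statement is faithful to it, (2) the Weierstrass model of
Cassels' curves with the two invariants the fact asks for (`c₄ = 0`, `Δ ≠ 0`), proved, and the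
formal reduction of the fact to the printed family statement, (3) the architecture of the
printed proof with the census of its prerequisites (written before the descent files below
existed), and (4) — section `DescentSkeleton` at the end, added with the library files
`Literature.NumberTheory.EllipticCurves.MordellCurveThreeDescent` (the genuine `μ₃`-Kummer torsor
classes `[C_m] ∈ H¹(ℚ, C_d)[3]`), `…Kernel` (`[C_m] = 0 ⇒ m ∈ δ(C'_d(ℚ)) ℚ*³`) and `…Local`
(`m ∈ δ(C'_d(ℚ_v)) ℚ_v*³ ⇒ [C_m]` dies in `H¹(ℚ_v, C_d)`) — the reduction
`Cassels1964_sha_threeRank_jZero_of_local_global` of the fact to the two halves of the printed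
Theorem in descent language (local solubility of all the torsors of a `(ℤ/3)^k` of monomials;
global insolubility of the non-trivial ones), so that what remains of the fact is exactly
Cassels' local analysis (p. 66) and his global argument (pp. 66–70: the second descent). No
discharge is attempted here; nothing new is assumed: this file introduces no `def … : Prop`.

## (1) What is printed (p. 65), and faithfulness

"**Theorem.** Let `p_j (1 ≤ j ≤ T)` be distinct positive rational primes of the form `9n + 8`
and put (1) `P = ∏_{1 ≤ j ≤ T} p_j`. Then there exists a rational integer `d` divisible by `P`
and such that all the curves (2) `m x³ + m⁻¹ y³ + d z³ = 0` where (3) `m | P², m > 1`, have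
rational points everywhere locally but not globally (i.e. points in every `p`-adic field and in
the reals, but no rational points)." And then: "Let `C` be the 1-dimensional abelian variety
consisting of the curve (4) `x³ + y³ + d z³ = 0` with the law of addition in which `(1, −1, 0)`
is the zero point. A curve (2) […] can be given the structure of a (principal) homogeneous space
over `C`. In this way we get a mapping of the multiplicative group `ℚ*` of nonzero rationals
into the group `WC` of classes of homogeneous spaces, the kernel consisting of precisely those
`m` for which (2) has a rational point. By definition the Tate–Šafarevič group `Ш` consists of
those elements of `WC` which are everywhere locally trivial; and so `m` maps into an element of
`Ш` if and only if there is everywhere locally a point on (2). Hence the theorem implies that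
the order of `Ш` is at least `3^T`." [cite: Cassels1964ArithmeticVI, Theorem and p. 65]

The vendored fact reads `∀ k, ∃ W : WeierstrassCurve ℚ, W.IsElliptic ∧ W.c₄ = 0 ∧
nRankAtLeast (shaTorsion W 3) 3 k`. It IS the printed consequence: `C = C_d` is the Weierstrass
curve `casselsCurve d : y² = x³ − 432 d²` below (`c₄ = 0`, i.e. `j = 0`; `Δ = −2¹²3⁹d⁴ ≠ 0`;
the classical map `(x, y) ↦ (−12d/(x+y), −36d(x−y)/(x+y))` from `x³ + y³ + d = 0`,
`casselsCurve_equation`); the map `m ↦ [(2)]` is the homomorphism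
`ℚ*/ℚ*³ = H¹(ℚ, μ₃) = H¹(ℚ, C[τ]) → H¹(ℚ, C)` (`C[τ]` = the three flexes on `z = 0`, a Galois
module `≅ μ₃`), its values are killed by `3`, and by the Theorem it is injective on
`{m mod ℚ*³ : m | P²} ≅ (ℤ/3ℤ)^T` with image in `Ш` — Cassels' `Ш` being the classes trivial in
every `p`-adic field AND in the reals, i.e. the tree's `WeierstrassCurve.sha` (all finite and all
infinite places); so `rk₃ Ш(C_d/ℚ)[3] ≥ T`, and `T` is arbitrary (Dirichlet: infinitely many
primes `≡ 8 (mod 9)`). Statement CONFIRMED against the source; no discrepancy with the three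
reports. (MR 29 #104, *Reviews in Number Theory* G05-66, prints the same summary.)

## (2) What this file proves

* `casselsCurve d = ⟨0, 0, 0, 0, −432 d²⟩` over any commutative ring, `map`-compatible;
  `casselsCurve_c₄ : c₄ = 0`, `casselsCurve_Δ : Δ = −(2¹² · 3⁹) d⁴`; over `ℚ`:
  `isElliptic_casselsCurve` (`d ≠ 0`), `casselsCurve_j : j = 0`;
* `casselsCurve_equation`: a solution of `x³ + y³ + d = 0` with `x + y ≠ 0` gives the point
  `(−12d/(x+y), −36d(x−y)/(x+y))` of `casselsCurve d` (the identity
  `(x+y)³ + 3(x−y)²(x+y) = 4(x³ + y³)`);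
* `Cassels1964_sha_threeRank_jZero_of_family`: the fact follows from the family statement
  "for every `k` some `d ≠ 0` has `rk₃ Ш(C_d/ℚ)[3] ≥ k`" for these models — the formal shape in
  which a future discharge must deliver Cassels' Theorem (with `k = T`, `d` as printed).

## (3) The printed proof (pp. 65–70) and why no discharge is attempted

p. 65: "The proof of this result relies heavily on the machinery developed in the first paper of
this series [1]; indeed this paper should be regarded as an appendix to [1]" ([1] = Cassels,
*Arithmetic on curves of genus 1. I. On a conjecture of Selmer*, J. reine angew. Math. 202
(1959) 52–99). Its steps, as printed:
* LOCAL (p. 66): "It is enough to choose `d` to be the product of distinct positive prime factors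
  `q` of the form `9n + 8` and divisible by `P`. […] the only local fields where there might not
  be a point on (2) are the 3-adic and the `q`-adic, where `q` is any prime divisor of `d`. It is
  readily checked that there are points on (2) over these fields."
* GLOBAL (p. 66): "We shall actually prove that there are no points on (2) defined over `ℚ(ρ)`,
  and so can use the theory of [1]. There it is shown that there is a pairing (6)
  `U(m₁, m₂) = 1, ρ or ρ²` which is defined whenever (2) with `m = m₁` and `m = m₂` is everywhere
  locally soluble and is such that `U(m₁, m₂)` is certainly 1 for every `m₂` if there is a point
  on (2) defined over `ℚ(ρ)` with `m = m₁`" (footnote 6: "The pairing is a special case of that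
  defined in [2]" — [2] = Cassels IV, the Cassels–Tate pairing — "Note that we are using only the
  easier half ('necessary') of Theorem IV of [1]"). With `m₁, …, m_I` (`I = 3^T − 1`) the `m` of
  (3) and auxiliary primes `q₁, …, q_I, q_{I+1} ≡ 8 (mod 9)`: (7) `U(m_i, q_i) ≠ 1 (1 ≤ i ≤ I)`
  when (8) `d = p₁⋯p_T q₁⋯q_I q_{I+1}`; "(7) will imply the truth of the Theorem" (p. 67).
* EVALUATION OF `U` (p. 67): "If (2) is everywhere locally soluble, then a general existence
  theorem of Class Field Theory due to Hasse shows that (9) `m = Norm_{ℚ(ρ,d^{1/3})/ℚ(ρ)} β`";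
  an `l ∈ ℚ(ρ)` with (10) `l β^{D−D²}` an ideal cube; (11) `U(m, q) = (l⁻¹l_τ, q / τ)(l⁻¹, q / q)`,
  "Hilbert Norm Residue Symbols" in `ℚ(ρ)`, `τ = ρ − ρ² = √−3` (formulae (4), (7) of Appendix B
  of [1]); `d` is sought as (13) `d = Norm_{Ω/ℚ} δ`, `Ω = ℚ(p₁^{1/3}, …, p_T^{1/3})`.
* Lemma 1 (pp. 67–68, "a partial restatement of Lemma 13 of [1]") and Lemma 2 (p. 68,
  "straightforward local considerations"): the explicit `β` from `Δ ∈ ℚ(ρ, m^{1/3})` with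
  `Norm Δ = d`, and `l (mod 𝔮)`.
* CHOICE OF `δ` (pp. 68–70): divisibility by first-degree primes `𝔓_j, 𝔔_i` of `Ω` (17);
  `d' > 0` (18); `d' ≡ 8 (mod 9)` (19); a 3-adic congruence (20); congruences (21) modulo
  `𝔔, 𝔔*` giving (22) `(l, q / q) = (v̄, q / q)` any prescribed value, hence (23)
  `U(m_i, q_i) ≠ 1`; and (p. 70) "by the generalized theorem about the existence of prime
  ideals in arithmetic progressions (see [3], [4], [5])" (Hasse's *Bericht*; Hecke 1917; Landau
  1918) "we may choose `δ` to satisfy the conditions laid down and so that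
  `(𝔓₁⋯𝔓_T𝔔₁⋯𝔔_I)⁻¹ δ` is a first degree prime ideal of `Ω`."

Prerequisites of a formal discharge, therefore (census against Mathlib and the tree,
2026-08-15): (a) the pairing `U` of [1], Theorem IV — the Cassels–Tate pairing on the `τ`-Selmer
group of `x³ + y³ + dz³ = 0` over `ℚ(ρ)`, bilinear and annihilating the classes with a
`ℚ(ρ)`-point (the tree has no Cassels–Tate pairing; local Tate duality is itself the undischarged
named fact `Literature.NumberTheory.GaloisRepresentations.exists_perfectPairing_galoisCohomology_tateDual`);
(b) cubic Hilbert norm-residue symbols in `ℚ(ρ)` with their reciprocity (Mathlib and the tree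
have quadratic symbols only); (c) Hasse's norm theorem for the cyclic cubic extension
`ℚ(ρ, d^{1/3})/ℚ(ρ)` (the tree vendors the quadratic case only,
`Literature.NumberTheory.Automorphic.hilbertSymbol_eq_one_of_forall_completions`); (d) first-degree
prime ideals of the non-Galois field `Ω` of degree `3^T` in a prescribed ray class (Hecke–Landau;
the tree's proved `Literature.NumberTheory.Automorphic.chebotarev_artinRep_holds` is the
Frobenius-class form over a Galois extension, not this ray-class form); (e) the classes of the
torsors (2) in the tree's continuous `H¹(Γ_ℚ, C(ℚ̄))` (Kummer theory with `μ₃`-coefficients, on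
which `Γ_ℚ` acts non-trivially) with their local triviality at `3`, at `q | d`, at the good
primes and at `∞` — the analogue of `Literature.NumberTheory.EllipticCurves.Kramer1983_shaG_of_selmerG_holds`
and `Kramer1983_selmerG_generators_local_holds`, which close Kramer's `2`-torsion companion fact
`Kramer1983_sha_twoRank_semistable` of the same barrier entry (there `A[2] ⊆ A(ℚ)` makes the full
`2`-descent elementary; here `C_d[3]` generates `ℚ(ρ, d^{1/3})`, the field of [1]). Items (a)–(d)
are class field theory over `ℚ(ρ)` and the Cassels–Tate pairing, i.e. theories rather than
lemmas, which is why the provefact triage of this fact is XL and no discharge is attempted here.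
(Triage note of the vendor, not printed in the source: the everywhere-local solubility of the
`3^T − 1` torsors alone — a lower bound for the `τ`-Selmer group — yields no element of `Ш`
without an independent bound on the Mordell–Weil group, which the source obtains from the
pairing `U`, i.e. from the second descent of [1] over `ℚ(ρ, d^{1/3})`.)

## References

* [Cassels1964ArithmeticVI] J. W. S. Cassels, J. reine angew. Math. 214/215 (1964) 65–70,
  doi:10.1515/crll.1964.214-215.65 — READ in full for this file (GDZ scan, pp. 65–70): Theorem
  and the paragraph following it (p. 65), the local paragraph and the pairing `U` (p. 66),
  (8)–(14) and Lemma 1 (p. 67), Lemma 2 and (17)–(18) (p. 68), (19)–(23) (p. 69), the final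
  density step and the reference list [1]–[6] (p. 70).
* MR 29 #104 (P. Abellanas) = G05-66 in W. J. LeVeque (ed.), *Reviews in Number Theory
  1940–72*, vol. 2 (AMS 1974) — read (the printed summary of the theorem).
* J. W. S. Cassels, *Arithmetic on curves of genus 1. I. On a conjecture of Selmer*, J. reine
  angew. Math. 202 (1959) 52–99 — NOT read (cited by the source as [1]; known here through
  MR 22 #24 = G05-59, read, which prints its Theorem VII: for `m₁, m₂ ∈ K* ∖ K*³` with points
  over `K ∋ ρ` on `m_j⁻¹X³ + m_jY³ + dZ³ = 0`, "`m₂` is the norm of an element of `K(m₁^{1/3})`").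
-/

noncomputable section

open scoped Classical

open WeierstrassCurve

namespace Literature.Barriers.BirchSwinnertonDyer

/-! ### The Weierstrass model of Cassels' curves `x³ + y³ + d z³ = 0` -/

section Model

variable {R : Type*} [CommRing R]

/-- **Cassels' curve `C_d` in Weierstrass form**: `y² = x³ − 432 d²`, i.e.
`(a₁, a₂, a₃, a₄, a₆) = (0, 0, 0, 0, −432 d²)`, the Weierstrass model of the plane cubic (4)
`x³ + y³ + d z³ = 0` with zero `(1, −1, 0)` of the source (over a field of characteristic `0`
the affine piece `x³ + y³ + d = 0`, `x + y ≠ 0`, maps to it by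
`(x, y) ↦ (−12d/(x+y), −36d(x−y)/(x+y))`, `casselsCurve_equation`; the model depends on `d²`
only, as `d ↦ −d` is `(x, y, z) ↦ (x, y, −z)` on (4)). A curve of `j`-invariant `0`
(`casselsCurve_c₄`, `casselsCurve_j`). Defined over any commutative ring.
[cite: Cassels1964ArithmeticVI, p. 65 (4)] -/
def casselsCurve (d : R) : WeierstrassCurve R :=
  ⟨0, 0, 0, 0, -(432 * d ^ 2)⟩

/-- `casselsCurve` is compatible with ring homomorphisms. [folklore] -/
theorem map_casselsCurve {S : Type*} [CommRing S] (f : R →+* S) (d : R) :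
    (casselsCurve d).map f = casselsCurve (f d) := by
  simp [casselsCurve, WeierstrassCurve.map, map_ofNat]

/-- `c₄(C_d) = b₂² − 24 b₄ = 0`: the model has `a₁ = a₂ = a₃ = a₄ = 0`. This is the spelling
`c₄ = 0` of "`j`-invariant zero" used by the named fact `Cassels1964_sha_threeRank_jZero`.
[folklore] -/
theorem casselsCurve_c₄ (d : R) : (casselsCurve d).c₄ = 0 := by
  simp only [casselsCurve, c₄, b₂, b₄]; ring

/-- `Δ(C_d) = −27 b₆² = −27 (4a₆)² = −432 a₆² = −432³ d⁴ = −2¹² 3⁹ d⁴` (`b₂ = b₄ = b₈ = 0`,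
`b₆ = 4a₆`). [folklore] -/
theorem casselsCurve_Δ (d : R) : (casselsCurve d).Δ = -(2 ^ 12 * 3 ^ 9) * d ^ 4 := by
  simp only [casselsCurve, Δ, b₂, b₄, b₆, b₈]; ring

/-- **The cubic maps to the Weierstrass model.** Over a field of characteristic `0`, if
`x³ + y³ + d = 0` and `x + y ≠ 0` then `(X, Y) = (−12d/(x+y), −36d(x−y)/(x+y))` satisfies
`Y² = X³ − 432 d²` — the identity `4(x³ + y³) = (x+y)³ + 3(x+y)(x−y)²`. (On (4) with `z = 0`
lie only the zero `(1, −1, 0)` and the two flexes `(1, −ρ, 0)`, `(1, −ρ², 0)`; `x + y = 0` with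
`z = 1` forces `d = 0`.) [folklore] -/
theorem casselsCurve_equation {F : Type*} [Field F] [CharZero F] {d x y : F} (hs : x + y ≠ 0)
    (h : x ^ 3 + y ^ 3 + d = 0) :
    (casselsCurve d).toAffine.Equation (-(12 * d) / (x + y)) (-(36 * d * (x - y)) / (x + y)) := by
  rw [WeierstrassCurve.Affine.equation_iff]
  simp only [casselsCurve]
  field_simp
  linear_combination (1728 : F) * d ^ 2 * h

end Model

/-- `C_d` is an elliptic curve over `ℚ` for `d ≠ 0` (`Δ = −2¹²3⁹d⁴ ≠ 0`). [folklore] -/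
theorem isElliptic_casselsCurve {d : ℚ} (hd : d ≠ 0) : (casselsCurve d).IsElliptic := by
  rw [WeierstrassCurve.isElliptic_iff, casselsCurve_Δ, isUnit_iff_ne_zero]
  exact mul_ne_zero (by norm_num) (pow_ne_zero 4 hd)

/-- `j(C_d) = c₄³/Δ = 0` for `d ≠ 0`: Cassels' examples "all have `j = 0`" (Clark–Sharif 2010,
§1.3; Kramer 1983, §1). [cite: Cassels1964ArithmeticVI, p. 65 (4)] -/
theorem casselsCurve_j {d : ℚ} (hd : d ≠ 0) :
    @WeierstrassCurve.j ℚ _ (casselsCurve d) (isElliptic_casselsCurve hd) = 0 := by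
  haveI := isElliptic_casselsCurve hd
  rw [WeierstrassCurve.j, casselsCurve_c₄]
  simp

/-! ### The reduction of the named fact to the printed family statement -/

/-- **`Cassels1964_sha_threeRank_jZero` from the family statement for Cassels' models.** If for
every `k` some `d ≠ 0` has `rk₃ Ш(C_d/ℚ)[3] ≥ k` — which is what the printed Theorem delivers
with `k = T`, `d = p₁⋯p_T q₁⋯q_I q_{I+1}` as in (8), the `(ℤ/3ℤ)^T` being the classes of the
torsors (2), `m | P²` (p. 65: "the theorem implies that the order of `Ш` is at least `3^T`") —
then the barrier-catalogue fact holds, the witnesses `C_d = casselsCurve d` being elliptic with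
`c₄ = 0`. The hypothesis is the family statement itself, kept as a binder of this reduction (it
is not vendored as a separate named fact). [cite: Cassels1964ArithmeticVI, Theorem and p. 65] -/
theorem Cassels1964_sha_threeRank_jZero_of_family
    (h : ∀ k : ℕ, ∃ d : ℚ, d ≠ 0 ∧ nRankAtLeast (shaTorsion (casselsCurve d) 3) 3 k) :
    Cassels1964_sha_threeRank_jZero := by
  intro k
  obtain ⟨d, hd, hk⟩ := h k
  exact ⟨casselsCurve d, isElliptic_casselsCurve hd, casselsCurve_c₄ d, hk⟩

/-- The same reduction with integral parameters `d ∈ ℤ ∖ {0}`, as printed ("a rational integer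
`d` divisible by `P`"). [cite: Cassels1964ArithmeticVI, Theorem] -/
theorem Cassels1964_sha_threeRank_jZero_of_family_int
    (h : ∀ k : ℕ, ∃ d : ℤ, d ≠ 0 ∧ nRankAtLeast (shaTorsion (casselsCurve (d : ℚ)) 3) 3 k) :
    Cassels1964_sha_threeRank_jZero :=
  Cassels1964_sha_threeRank_jZero_of_family fun k =>
    let ⟨d, hd, hk⟩ := h k
    ⟨(d : ℚ), Int.cast_ne_zero.mpr hd, hk⟩

/-! ### The descent skeleton: the fact from the two halves of Cassels' Theorem in descent language

With the `μ₃`-Kummer torsor classes `[C_m] ∈ H¹(ℚ, C_d)[3]` of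
`Literature.NumberTheory.EllipticCurves.MordellCurveThreeDescent` (`casselsCurve d` IS
`mordellCurve (−432 d²)`, `c = 12 d`), their kernel (`MordellCurveThreeDescentKernel`:
`[C_m] = 0 ⇒ m ∈ δ(C'_d(ℚ)) · ℚ*³`, `δ = phiDescent (12 d)` the `φ`-descent map on
`C'_d : Y² = X³ + 81 c²`) and their local conditions (`MordellCurveThreeDescentLocal`:
`m ∈ δ(C'_d(ℚ_v)) · ℚ_v*³ ⇒ [C_m]` dies in `H¹(ℚ_v, C_d)`), the named fact follows from the two
halves of the printed Theorem stated in descent language for a family of parameters: for every `k`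
there are `d ≠ 0` and `a₁, …, a_k ∈ ℚ*` (Cassels: `k = T`, `d = p₁⋯p_T q₁⋯q_I q_{I+1}` of (8),
`a_j = p_j`) such that every monomial `m = ∏ a_i^{e_i}`, `e ∈ {0,1,2}^k` (Cassels: the `m | P²` of
(3)) is LOCALLY a descent value at every place of `ℚ` ("(2) has points in every `p`-adic field and
in the reals") while for `e ≠ 0` it is NOT a descent value over `ℚ` ("but no rational points";
"the kernel consisting of precisely those `m` for which (2) has a rational point"). Then
`e ↦ [C_{m(e)}]` embeds `(ℤ/3ℤ)^k` into `Ш(C_d/ℚ)[3]` ("Hence the theorem implies that the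
order of `Ш` is at least `3^T`", p. 65): `Cassels1964_sha_threeRank_jZero_of_local_global`. The two
halves are the binders `hloc`/`hglob` packaged in the hypothesis of the reduction; they are NOT
vendored as named facts. -/

section DescentSkeleton

open Literature.NumberTheory.EllipticCurves Literature.NumberTheory.EllipticCurves.MordellDescent
open NumberField IsDedekindDomain

/-- `casselsCurve d = mordellCurve (−432 d²)` (definitional). [folklore] -/
theorem casselsCurve_eq_mordellCurve (d : ℚ) : casselsCurve d = mordellCurve (-(432 * d ^ 2)) := rfl

/-- `−432 d² = −3 (12 d)²`. [folklore] -/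
theorem cassels_hD (d : ℚ) : -(432 * d ^ 2) = -3 * (12 * d) ^ 2 := by ring

/-- `12 d ≠ 0` for `d ≠ 0`. [folklore] -/
theorem cassels_hc {d : ℚ} (hd : d ≠ 0) : (12 : ℚ) * d ≠ 0 := mul_ne_zero (by norm_num) hd

variable {k : ℕ} {d : ℚ} {a : Fin k → ℚ}

/-- A monomial `∏ aᵢ^{nᵢ}` in non-zero rationals is non-zero. [folklore] -/
theorem mono_ne_zero (ha : ∀ i, a i ≠ 0) (n : Fin k → ℕ) : ∏ i, a i ^ n i ≠ 0 :=
  Finset.prod_ne_zero_iff.mpr fun i _ => pow_ne_zero _ (ha i)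

/-- **`[C_{∏ aᵢ^{nᵢ}}] = Σ nᵢ [C_{aᵢ}]`**: the classes are multiplicative in `a`
(`MordellDescent.torsorClassHom` is a monoid homomorphism on `ℚˣ`). [folklore] -/
theorem torsorClass_mono (hd : d ≠ 0) (ha : ∀ i, a i ≠ 0) (n : Fin k → ℕ) :
    torsorClass (cassels_hc hd) (cassels_hD d) (mono_ne_zero ha n) =
      ∑ i, n i • torsorClass (cassels_hc hd) (cassels_hD d) (ha i) := by
  set u : Fin k → ℚˣ := fun i => Units.mk0 (a i) (ha i) with hu
  have hprod : ((∏ i, u i ^ n i : ℚˣ) : ℚ) = ∏ i, a i ^ n i := by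
    rw [Units.coe_prod]; simp [hu]
  have h1 := map_prod (torsorClassHom (cassels_hc hd) (cassels_hD d)) (fun i => u i ^ n i) Finset.univ
  simp only [map_pow, torsorClassHom_apply] at h1
  have h2 := congrArg Multiplicative.toAdd h1
  rw [toAdd_ofAdd, toAdd_prod] at h2
  simp only [toAdd_pow, toAdd_ofAdd] at h2
  exact (torsorClass_congr _ _ _ _ hprod.symm).trans h2

/-- Integer multiples of a class killed by `3` only depend on the coefficient mod `3`. [folklore] -/
theorem zsmul_eq_val_nsmul {M : Type*} [AddCommGroup M] {x : M} (hx : 3 • x = 0) (c : ℤ) :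
    c • x = ((c : ZMod 3)).val • x := by
  have h3 : ((((c : ZMod 3)).val : ℕ) : ℤ) = c % 3 := ZMod.val_intCast c
  have hx3 : (3 : ℤ) • x = 0 := by rw [show (3 : ℤ) = ((3 : ℕ) : ℤ) from rfl, natCast_zsmul, hx]
  calc c • x = (c % 3 + c / 3 * 3) • x := by rw [Int.emod_add_ediv_mul]
    _ = (c % 3) • x := by rw [add_zsmul, mul_zsmul, hx3, zsmul_zero, add_zero]
    _ = ((((c : ZMod 3)).val : ℕ) : ℤ) • x := by rw [h3]
    _ = ((c : ZMod 3)).val • x := natCast_zsmul _ _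

/-- **The descent skeleton.** `Cassels1964_sha_threeRank_jZero` follows from: for every `k`, some
`d ≠ 0` and `a₁, …, a_k ∈ ℚ*` such that, with `c = 12d`, `C'_d = mordellCurve (81 c²)` and
`δ = phiDescent c` the `φ`-descent map,
(LOCAL) for every `e ∈ (ℤ/3)^k` the monomial `m(e) = ∏ aᵢ^{eᵢ}` is a descent value times a cube
over every completion of `ℚ` — `δ(P') = m(e) w³` for some `P' ∈ C'_d(ℚ_v)`, `w ∈ ℚ_v*`, at each
finite `v`, and likewise at the infinite place — and
(GLOBAL) for `e ≠ 0` it is not one over `ℚ`.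
For Cassels' `d = p₁⋯p_T q₁⋯q_{I+1}` and `aⱼ = pⱼ` these are the two halves of the printed Theorem
("the curves (2), `m | P², m > 1`, have rational points everywhere locally but not globally") read
through the torsor dictionary of p. 65 ("`m` maps into an element of `Ш` if and only if there is
everywhere locally a point on (2)"; "the kernel consisting of precisely those `m` for which (2)
has a rational point"). Proof: `gᵢ = [C_{aᵢ}] ∈ Ш(C_d/ℚ)[3]` (`three_nsmul_torsorClass`,
`torsorClass_mem_localRestrictionKer` at every place), and `Σ cᵢ gᵢ = [C_{m(c mod 3)}] = 0` forces
`m(c mod 3) ∈ δ(C'_d(ℚ)) ℚ*³` (`exists_phiDescent_eq_of_torsorClass_eq_zero`), hence `3 | cᵢ` by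
(GLOBAL); `nRankAtLeast.of_indep` concludes. [cite: Cassels1964ArithmeticVI, Theorem and p. 65] -/
theorem Cassels1964_sha_threeRank_jZero_of_local_global
    (h : ∀ k : ℕ, ∃ (d : ℚ) (a : Fin k → ℚ), d ≠ 0 ∧ (∀ i, a i ≠ 0) ∧
      ∀ e : Fin k → ZMod 3,
        (∀ v : HeightOneSpectrum (𝓞 ℚ),
          ∃ (P : (mordellCurve (81 * algebraMap ℚ (v.adicCompletion ℚ) (12 * d) ^ 2)).toAffine.Point)
            (w : v.adicCompletion ℚ), w ≠ 0 ∧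
            phiDescent (algebraMap ℚ (v.adicCompletion ℚ) (12 * d)) P =
              algebraMap ℚ (v.adicCompletion ℚ) (∏ i, a i ^ (e i).val) * w ^ 3) ∧
        (∀ w : InfinitePlace ℚ,
          ∃ (P : (mordellCurve (81 * algebraMap ℚ w.Completion (12 * d) ^ 2)).toAffine.Point)
            (t : w.Completion), t ≠ 0 ∧
            phiDescent (algebraMap ℚ w.Completion (12 * d)) P =
              algebraMap ℚ w.Completion (∏ i, a i ^ (e i).val) * t ^ 3) ∧
        (e ≠ 0 → ∀ (P : (mordellCurve (81 * (12 * d) ^ 2)).toAffine.Point) (w : ℚ), w ≠ 0 →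
          phiDescent (12 * d) P ≠ (∏ i, a i ^ (e i).val) * w ^ 3)) :
    Cassels1964_sha_threeRank_jZero := by
  refine Cassels1964_sha_threeRank_jZero_of_family fun k => ?_
  obtain ⟨d, a, hd, ha, hfam⟩ := h k
  refine ⟨d, hd, ?_⟩
  -- the classes of all monomials lie in `Ш(C_d/ℚ)[3]`
  have hmem : ∀ n : Fin k → ZMod 3,
      torsorClass (cassels_hc hd) (cassels_hD d) (mono_ne_zero ha fun i => (n i).val) ∈
        shaTorsion (casselsCurve d) 3 := by
    intro n
    obtain ⟨hfin, hinf, -⟩ := hfam n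
    refine AddSubgroup.mem_inf.mpr ⟨(WeierstrassCurve.mem_sha_iff _ _).mpr ⟨fun v => ?_, fun w => ?_⟩, ?_⟩
    · exact torsorClass_mem_localRestrictionKer (cassels_hc hd) (cassels_hD d) _ (hfin v)
    · exact torsorClass_mem_localRestrictionKer (cassels_hc hd) (cassels_hD d) _ (hinf w)
    · exact AddSubgroup.torsionBy.nsmul_iff.mpr (three_nsmul_torsorClass _ _ _)
  -- the generators `gᵢ = [C_{aᵢ}]`
  have hsingle : ∀ i : Fin k, ∏ j, a j ^ ((Pi.single i (1 : ZMod 3) : Fin k → ZMod 3) j).val = a i := by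
    intro i
    rw [Finset.prod_eq_single i (fun j _ hj => by rw [Pi.single_eq_of_ne hj, ZMod.val_zero, pow_zero])
      (fun hi => absurd (Finset.mem_univ i) hi), Pi.single_eq_same, ZMod.val_one, pow_one]
  have hgi : ∀ i : Fin k, torsorClass (cassels_hc hd) (cassels_hD d) (ha i) ∈ shaTorsion (casselsCurve d) 3 := by
    intro i
    rw [← torsorClass_congr (cassels_hc hd) (cassels_hD d) (mono_ne_zero ha fun j =>
      ((Pi.single i (1 : ZMod 3) : Fin k → ZMod 3) j).val) (ha i) (hsingle i)]
    exact hmem _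
  refine nRankAtLeast.of_indep (p := 3) (e := 1) Nat.prime_three le_rfl
    (fun i => (⟨torsorClass (cassels_hc hd) (cassels_hD d) (ha i), hgi i⟩ : ↥(shaTorsion (casselsCurve d) 3)))
    (fun i => ?_) ?_
  · apply Subtype.ext
    change 3 ^ 1 • torsorClass (cassels_hc hd) (cassels_hD d) (ha i) = 0
    rw [pow_one]; exact three_nsmul_torsorClass _ _ _
  · intro c hc i
    -- `Σ cᵢ gᵢ = [C_{m(c mod 3)}]`
    have hsum : torsorClass (cassels_hc hd) (cassels_hD d) (mono_ne_zero ha fun j => ((c j : ZMod 3)).val) = 0 := by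
      have h0 := congrArg (fun x : ↥(shaTorsion (casselsCurve d) 3) => (x : (casselsCurve d).galH1)) hc
      simp only [Nat.sub_self, pow_zero, mul_one, AddSubgroup.val_finsetSum, AddSubgroup.coe_zsmul,
        AddSubgroup.coe_zero] at h0
      rw [torsorClass_mono hd ha]
      refine Eq.trans (Finset.sum_congr rfl fun j _ => ?_) h0
      exact (zsmul_eq_val_nsmul (three_nsmul_torsorClass _ _ _) (c j)).symm
    -- so `m(c mod 3)` is a global descent value, which (GLOBAL) forbids unless `c ≡ 0`
    obtain ⟨P, w, hw, hP⟩ := exists_phiDescent_eq_of_torsorClass_eq_zero (cassels_hc hd) (cassels_hD d) _ hsum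
    obtain ⟨-, -, hglob⟩ := hfam fun j => (c j : ZMod 3)
    by_contra hdiv
    have hne : (fun j => ((c j : ℤ) : ZMod 3)) ≠ 0 := by
      intro h0
      apply hdiv
      have := congrFun h0 i
      simp only [Pi.zero_apply] at this
      exact (ZMod.intCast_zmod_eq_zero_iff_dvd (c i) 3).mp this
    exact hglob hne P w hw hP

end DescentSkeleton

end Literature.Barriers.BirchSwinnertonDyer

end
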